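import Summits.Ventures.PercRepro.RankLevelSetRuleQSliceDiag
import Summits.Ventures.PercRepro.RankLevelSetRuleQNoFiveUpModel
import Summits.Ventures.PercRepro.RankLevelSetRuleQSliceMapsModel

/-!
# PercRepro — THE NEGATIVE HALF OF THE SLICE MAP FOR EVERY FAMILY `k ≥ 5`: RULE Q'S EQUAL SPLIT FAILS ON EVERY
TRUNCATED SLICE `2 ≤ u ≤ k − 3` FROM `q = 4^{k+3} + u` ON (night-1, gen 20; dossier §31)

On the cell `(q+k, q)` at the tight layer, a member at distance `u = q − #P` from the top receives at least `R̂(q, k, q−u)`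
under Rule Q's equal split (`rhat_le_ruleQRecv`), and on the model matroid exactly that (`modelRecvEq_flatPart`). The
thin-slice maps of gens 18–19 (`rhat_thin_slice_iff`, `rhat_slice_iff_le_eight`) locate the slices Rule Q pays for
every `q` on the families `k ≤ 10`: `u ∉ [2, k − 3]`. This module proves the NEGATIVE half for EVERY family `k ≥ 5`
and EVERY truncated slice `2 ≤ u ≤ k − 3`, uniformly: `R̂(m + u, k, m) < Φ(m + u + k, m + u)` for every `m ≥ 4^{k+3}`.
The mechanism is the one of gen 16's `u = 2` theorem (`rhat_lt_phiK_of_five_le`), made slice-independent: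
* `Φ(q+k, q) ≥ k − 1` termwise (`phiK_ge_sub_one`), while on the slice `u ≥ 3`
  `R̂ ≤ (u+k)·S₁(q, m) + C(u+k, 2)·S₂(q, m) + 2^{u+k}·S₃(q−3, m)` (`rhat_le_three_parts`) — the `j = 1, 2` swap counts
  are untruncated (`mhat_two`, `mhat_three'`) and every `j ≥ 3` keeps its `tD = 3` term `C(q+a, a+3) ≤ m̂`
  (`mhat_ge_choose_three`);
* the slice sums are bounded by their diagonal values (RankLevelSetRuleQSliceDiag): `S₁ ≤ 1/2 + X/(2(2q+1))`,
  `S₂ ≤ 1/(2(q+1)) + X/(2(2q+1))`, `S₃(q−3, m) ≤ 1/(q−3)`, with `X/(2q+1) ≤ 1/E` for `E = 2^{k+3}`, `E² ≤ m`;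
* with `(2k−3)(k−1) ≤ 2^k` (`two_k_sub_three_mul_le_two_pow`) the bound is `< (u+k)/2 + 1/2 ≤ k − 1`
  (`slice_neg_finish`: the three error terms are `≤ 1/16 + (1/16 + 1/128) + 1/512`).
* **`rhat_lt_phiK_of_slice`** — `R̂(m+u, k, m) < Φ(m+u+k, m+u)` for `k ≥ 5`, `2 ≤ u ≤ k − 3`, `m ≥ 4^{k+3}`
  (`u = 2` is gen 16's theorem); **`not_rhat_slice_of_two_le`**; **`rhat_slice_only_if`** —
  `(∀ q ≥ u, Φ(q+k, q) ≤ R̂(q, k, q−u)) → u < 2 ∨ k − 2 ≤ u` for EVERY `k ≥ 5`: the set of slices Rule Q's equal split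
  pays on every cell of a family `k ≥ 5` is contained in `{0, 1} ∪ [k−2, ∞)` (on `k ≤ 8` it is exactly that set,
  `rhat_slice_iff_le_eight`).
* **`exists_unpaid_slice`** / **`ruleQ_slice_only_if`** — the same at the matroid level through the model identity
  `modelRecvEq_flatPart` (RankLevelSetRuleQSliceMapsModel): on every family `k ≥ 5` every truncated slice `2 ≤ u ≤ k − 3`
  carries an unpaid member on an explicit finite matroid (the model at `q = 4^{k+3} + u`).
The threshold `4^{k+3}` is crude (exact first failures `(8,5)`: `q = 126`, `(9,6)`: `541`, `(10,7)`: `695`, gen 18 / p4);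
twin: mining/night-1/g20/negall_twin.py (the bound chain exact). Axioms: standard.
-/

namespace PercRepro

open Finset

/-! ### §4 The swap counts on a slice `u ≥ 3`, and the three-part bound on `R̂` -/

/-- On a slice `q − m ≥ 3`, **`m̂(q, m; a, j) ≥ C(q+a, a+3)` for every `j ≥ 3`** (the `tD = 3` term of `mhat_eq`). -/
lemma mhat_ge_choose_three (q m a j : ℕ) (hj : 3 ≤ j) (hu : 3 ≤ q - m) :
    (q + a).choose (a + 3) ≤ mhat q m a j := by
  rw [mhat_eq]
  have h3 : 3 ∈ range (min j (q - m) + 1) := by rw [Finset.mem_range]; omega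
  calc (q + a).choose (a + 3) = 1 * (q + a).choose (a + 3) := (one_mul _).symm
    _ ≤ j.choose 3 * (q + a).choose (a + 3) := Nat.mul_le_mul_right _ (Nat.choose_pos hj)
    _ ≤ ∑ tD ∈ range (min j (q - m) + 1), j.choose tD * (q + a).choose (a + tD) :=
        Finset.single_le_sum (f := fun tD => j.choose tD * (q + a).choose (a + tD)) (fun i _ => Nat.zero_le _) h3

/-- For `j ≥ 3` on the slice `u = v + 3`: `Σ_a C(m, a)/m̂(q, m; a, j) ≤ S₃(q − 3, m)`. -/
lemma shat_le_slice_three (m v j : ℕ) (hj : 3 ≤ j) :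
    ∑ a ∈ range (m + 1), (m.choose a : ℚ) / (mhat (m + v + 3) m a j : ℚ)
      ≤ ∑ a ∈ range (m + 1), (m.choose a : ℚ) / ((m + v + 3 + a).choose (a + 3) : ℚ) := by
  refine Finset.sum_le_sum (fun a _ => ?_)
  apply div_le_div_of_nonneg_left (by positivity) (by exact_mod_cast Nat.choose_pos (by omega))
  exact_mod_cast mhat_ge_choose_three (m + v + 3) m a j hj (by omega)

/-- `Σ_{i < k−3} C(n, i+3) ≤ 2^n` for `k ≤ n + 1` (a partial row sum). -/
lemma sum_choose_shift_three_le_two_pow (n k : ℕ) (hkn : k ≤ n + 1) :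
    ∑ i ∈ range (k - 3), (n.choose (i + 3) : ℚ) ≤ (2 : ℚ) ^ n := by
  rcases Nat.lt_or_ge k 3 with hlt | hge
  · rw [show k - 3 = 0 by omega, Finset.sum_range_zero]; positivity
  have hsplit := Finset.sum_range_add (fun i => n.choose i) 3 (k - 3)
  have hsub : ∑ i ∈ range (3 + (k - 3)), n.choose i ≤ ∑ i ∈ range (n + 1), n.choose i := by
    rw [show 3 + (k - 3) = k by omega]
    exact Finset.sum_le_sum_of_subset_of_nonneg (Finset.range_mono hkn) (fun _ _ _ => Nat.zero_le _)
  rw [Nat.sum_range_choose] at hsub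
  have h' : ∑ i ∈ range (k - 3), n.choose (3 + i) ≤ 2 ^ n := by
    calc ∑ i ∈ range (k - 3), n.choose (3 + i)
        ≤ ∑ i ∈ range 3, n.choose i + ∑ i ∈ range (k - 3), n.choose (3 + i) := Nat.le_add_left _ _
      _ = ∑ i ∈ range (3 + (k - 3)), n.choose i := hsplit.symm
      _ ≤ 2 ^ n := hsub
  have hre : ∑ i ∈ range (k - 3), (n.choose (i + 3) : ℚ) = ((∑ i ∈ range (k - 3), n.choose (3 + i) : ℕ) : ℚ) := by
    push_cast
    exact Finset.sum_congr rfl (fun i _ => by rw [Nat.add_comm i 3])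
  rw [hre]
  exact_mod_cast h'

/-- **The three-part bound on `R̂(m+u, k, m)` on a slice `u = v + 3 ≥ 3`**:
`R̂ ≤ (u+k)·S₁(q, m) + C(u+k, 2)·S₂(q, m) + 2^{u+k}·S₃(q−3, m)`, `q = m + u`
(`j = 1, 2` untruncated — `mhat_two`, `mhat_three'` — and every `j ≥ 3` keeps its `tD = 3` term). -/
lemma rhat_le_three_parts (k m v : ℕ) (hk : 3 ≤ k) :
    rhat (m + v + 3) k m
      ≤ ((v + 3 + k : ℕ) : ℚ) * ∑ a ∈ range (m + 1), (m.choose a : ℚ) / ((m + v + 3 + 1 + a).choose (a + 1) : ℚ)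
        + ((v + 3 + k).choose 2 : ℚ) * ∑ a ∈ range (m + 1), (m.choose a : ℚ) / ((m + v + 3 + 2 + a).choose (a + 2) : ℚ)
        + (2 : ℚ) ^ (v + 3 + k) * ∑ a ∈ range (m + 1), (m.choose a : ℚ) / ((m + v + 3 + a).choose (a + 3) : ℚ) := by
  unfold rhat
  rw [sum_Ioo_nat, show k - (0 + 1) = (k - 3) + 1 + 1 by omega, Finset.sum_range_succ', Finset.sum_range_succ']
  simp only [zero_add, add_zero, show m + v + 3 + k - m = v + 3 + k by omega]
  have hm1 : ∀ a, mhat (m + v + 3) m a 1 = (m + v + 3 + 1 + a).choose (a + 1) := fun a => by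
    have h := mhat_two m (v + 2) a
    rw [show m + (v + 2) + 1 = m + v + 3 by ring] at h
    exact h
  have hm2 : ∀ a, mhat (m + v + 3) m a 2 = (m + v + 3 + 2 + a).choose (a + 2) := fun a => by
    have h := mhat_three' m (v + 1) a
    rw [show m + (v + 1) + 2 = m + v + 3 by ring] at h
    exact h
  simp only [show (1 : ℕ) + 1 = 2 from rfl, hm1, hm2, Nat.choose_one_right]
  push_cast
  have hrw1 : ∑ a ∈ range (m + 1), (m.choose a : ℚ) * ((v : ℚ) + 3 + k) / ((m + v + 3 + 1 + a).choose (a + 1) : ℚ)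
      = ((v : ℚ) + 3 + k) * ∑ a ∈ range (m + 1), (m.choose a : ℚ) / ((m + v + 3 + 1 + a).choose (a + 1) : ℚ) := by
    rw [Finset.mul_sum]; exact Finset.sum_congr rfl (fun a _ => by ring)
  have hrw2 : ∑ a ∈ range (m + 1), (m.choose a : ℚ) * ((v + 3 + k).choose 2 : ℚ) / ((m + v + 3 + 2 + a).choose (a + 2) : ℚ)
      = ((v + 3 + k).choose 2 : ℚ) * ∑ a ∈ range (m + 1), (m.choose a : ℚ) / ((m + v + 3 + 2 + a).choose (a + 2) : ℚ) := by
    rw [Finset.mul_sum]; exact Finset.sum_congr rfl (fun a _ => by ring)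
  have h3 : ∑ i ∈ range (k - 3), ∑ a ∈ range (m + 1),
        (m.choose a : ℚ) * ((v + 3 + k).choose (1 + (i + 1 + 1)) : ℚ) / (mhat (m + v + 3) m a (1 + (i + 1 + 1)) : ℚ)
      ≤ (2 : ℚ) ^ (v + 3 + k) * ∑ a ∈ range (m + 1), (m.choose a : ℚ) / ((m + v + 3 + a).choose (a + 3) : ℚ) := by
    have hS3 : ∀ i ∈ range (k - 3), ∑ a ∈ range (m + 1),
          (m.choose a : ℚ) * ((v + 3 + k).choose (1 + (i + 1 + 1)) : ℚ) / (mhat (m + v + 3) m a (1 + (i + 1 + 1)) : ℚ)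
        ≤ ((v + 3 + k).choose (i + 3) : ℚ)
          * ∑ a ∈ range (m + 1), (m.choose a : ℚ) / ((m + v + 3 + a).choose (a + 3) : ℚ) := by
      intro i _
      rw [show 1 + (i + 1 + 1) = i + 3 by ring, Finset.mul_sum]
      refine Finset.sum_le_sum (fun a _ => ?_)
      rw [show (m.choose a : ℚ) * ((v + 3 + k).choose (i + 3) : ℚ) / (mhat (m + v + 3) m a (i + 3) : ℚ)
          = ((v + 3 + k).choose (i + 3) : ℚ) * ((m.choose a : ℚ) / (mhat (m + v + 3) m a (i + 3) : ℚ)) by ring]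
      apply mul_le_mul_of_nonneg_left _ (by positivity)
      apply div_le_div_of_nonneg_left (by positivity) (by exact_mod_cast Nat.choose_pos (by omega))
      exact_mod_cast mhat_ge_choose_three (m + v + 3) m a (i + 3) (by omega) (by omega)
    calc ∑ i ∈ range (k - 3), ∑ a ∈ range (m + 1),
          (m.choose a : ℚ) * ((v + 3 + k).choose (1 + (i + 1 + 1)) : ℚ) / (mhat (m + v + 3) m a (1 + (i + 1 + 1)) : ℚ)
        ≤ ∑ i ∈ range (k - 3), ((v + 3 + k).choose (i + 3) : ℚ)
            * ∑ a ∈ range (m + 1), (m.choose a : ℚ) / ((m + v + 3 + a).choose (a + 3) : ℚ) := Finset.sum_le_sum hS3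
      _ = (∑ i ∈ range (k - 3), ((v + 3 + k).choose (i + 3) : ℚ))
            * ∑ a ∈ range (m + 1), (m.choose a : ℚ) / ((m + v + 3 + a).choose (a + 3) : ℚ) := by
          rw [Finset.sum_mul]
      _ ≤ (2 : ℚ) ^ (v + 3 + k) * ∑ a ∈ range (m + 1), (m.choose a : ℚ) / ((m + v + 3 + a).choose (a + 3) : ℚ) := by
          apply mul_le_mul_of_nonneg_right (sum_choose_shift_three_le_two_pow _ _ (by omega))
          exact Finset.sum_nonneg (fun a _ => by positivity)
  rw [hrw1, hrw2]
  linarith [h3]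

/-! ### §5 The finish, and the theorems -/

/-- `(2n+7)(n+4) ≤ 2^{n+5}`, i.e. `(2k−3)(k−1) ≤ 2^k` for `k = n + 5 ≥ 5` (induction from `28 ≤ 32`). -/
lemma two_k_sub_three_mul_le_two_pow : ∀ n : ℕ, (2 * n + 7) * (n + 4) ≤ 2 ^ (n + 5) := by
  intro n
  induction n with
  | zero => norm_num
  | succ n ih =>
    calc (2 * (n + 1) + 7) * (n + 1 + 4) ≤ 2 * ((2 * n + 7) * (n + 4)) := by nlinarith
      _ ≤ 2 * 2 ^ (n + 5) := by omega
      _ = 2 ^ (n + 1 + 5) := by ring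

/-- **The finish, pure `ℚ`**: with `8 ≤ E`, `(2k−3)(k−1) ≤ E/8`, `E² ≤ q`, `E² ≤ m'`, `X·E ≤ 2q+1`, the three slice-sum
bounds, `c₂ = (u+k)(u+k−1)/2` and `512·T ≤ E²`: `(u+k)·S₁ + c₂·S₂ + T·S₃ < k − 1` for `3 ≤ u ≤ k − 3`
(the three error terms are `≤ 1/16 + (1/16 + 1/128) + 1/512 < 1/2`). -/
lemma slice_neg_finish (u k q m' X E S1 S2 S3 c2 T : ℚ) (hk : 5 ≤ k) (hu : 3 ≤ u) (huk : u + 3 ≤ k)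
    (hE8 : 8 ≤ E) (hE : (2 * k - 3) * (k - 1) ≤ E / 8) (hq : E ^ 2 ≤ q) (hm' : E ^ 2 ≤ m')
    (hXE : X * E ≤ 2 * q + 1)
    (hS1 : S1 ≤ 1 / 2 + X / (2 * (2 * q + 1))) (hS2 : S2 ≤ 1 / (2 * (q + 1)) + X / (2 * (2 * q + 1)))
    (hS3 : S3 ≤ 1 / m') (hc2 : c2 = (u + k) * (u + k - 1) / 2) (hT0 : 0 ≤ T) (hT : T * 512 ≤ E ^ 2) :
    (u + k) * S1 + c2 * S2 + T * S3 < k - 1 := by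
  have hEpos : 0 < E := by linarith
  have hqpos : 0 < q := by nlinarith
  have hm'pos : 0 < m' := by nlinarith
  have huk0 : 0 ≤ u + k := by linarith
  -- the coefficient bounds: u + k ≤ 2k − 3 ≤ E/8, c₂ ≤ (2k−3)(k−2) ≤ E/8
  have hA8 : 8 * (u + k) ≤ E := by nlinarith
  have hc2nn : 0 ≤ c2 := by rw [hc2]; nlinarith
  have hc28 : 8 * c2 ≤ E := by
    rw [hc2]
    have : (u + k) * (u + k - 1) ≤ (2 * k - 3) * (2 * k - 4) := by
      nlinarith [mul_nonneg (by linarith : (0 : ℚ) ≤ 2 * k - 3 - (u + k)) (by linarith : (0 : ℚ) ≤ 2 * k - 4 + (u + k))]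
    nlinarith
  -- the three elementary bounds on the slice sums
  have hXq : X / (2 * (2 * q + 1)) ≤ 1 / (2 * E) := by
    rw [div_le_div_iff₀ (by positivity) (by positivity)]; nlinarith [hXE]
  have h1q : 1 / (2 * (q + 1)) ≤ 1 / (2 * E ^ 2) := by
    apply one_div_le_one_div_of_le (by positivity); linarith
  have h1m : 1 / m' ≤ 1 / E ^ 2 := one_div_le_one_div_of_le (by positivity) hm'
  have hA : (u + k) * S1 ≤ (u + k) * (1 / 2 + 1 / (2 * E)) := by
    apply mul_le_mul_of_nonneg_left _ huk0; linarith
  have hB : c2 * S2 ≤ c2 * (1 / (2 * E ^ 2) + 1 / (2 * E)) := by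
    apply mul_le_mul_of_nonneg_left _ hc2nn; linarith
  have hC : T * S3 ≤ T * (1 / E ^ 2) := mul_le_mul_of_nonneg_left (hS3.trans h1m) hT0
  -- the numbers
  have hA' : (u + k) * (1 / (2 * E)) ≤ 1 / 16 := by
    rw [mul_one_div, div_le_div_iff₀ (by positivity) (by norm_num)]; nlinarith [hA8]
  have hB1 : c2 * (1 / (2 * E)) ≤ 1 / 16 := by
    rw [mul_one_div, div_le_div_iff₀ (by positivity) (by norm_num)]; nlinarith [hc28]
  have hB2 : c2 * (1 / (2 * E ^ 2)) ≤ 1 / 128 := by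
    rw [mul_one_div, div_le_div_iff₀ (by positivity) (by norm_num)]; nlinarith [hc28, hE8]
  have hC' : T * (1 / E ^ 2) ≤ 1 / 512 := by
    rw [mul_one_div, div_le_div_iff₀ (by positivity) (by norm_num)]; linarith [hT]
  have hA2 : (u + k) * (1 / 2 + 1 / (2 * E)) = (u + k) / 2 + (u + k) * (1 / (2 * E)) := by ring
  have hB3 : c2 * (1 / (2 * E ^ 2) + 1 / (2 * E)) = c2 * (1 / (2 * E ^ 2)) + c2 * (1 / (2 * E)) := by ring
  have huk2 : (u + k) / 2 ≤ (2 * k - 3) / 2 := by linarith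
  linarith [hA, hB, hC, hA', hB1, hB2, hC', hA2, hB3, huk2]

/-- **Rule Q's equal split fails on every truncated slice `3 ≤ u ≤ k − 3` of every family `k ≥ 5`**:
`R̂(m+u, k, m) < Φ(m+u+k, m+u)` for every `m ≥ 4^{k+3}` (written with `u = v + 3`, `v + 6 ≤ k`). -/
theorem rhat_lt_phiK_of_slice_three_le (k v m : ℕ) (hk : 5 ≤ k) (hvk : v + 6 ≤ k) (hm : 4 ^ (k + 3) ≤ m) :
    rhat (m + v + 3) k m < phiK (m + v + 3 + k) (m + v + 3) := by
  have hphi := phiK_ge_sub_one (m + v + 3) k (by omega)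
  have hR := rhat_le_three_parts k m v (by omega)
  have h4 : 0 < 4 ^ (k + 3) := by positivity
  have hE2 : (2 ^ (k + 3)) ^ 2 = 4 ^ (k + 3) := by rw [← pow_mul, pow_mul']; norm_num
  -- the slice sums against their diagonal values
  have hS1 := (slice_mono_m (m + v + 3) 1 (by omega : m ≤ m + v + 3)).trans (slice_one_diag (m + v + 3)).le
  have hS2 := (slice_mono_m (m + v + 3) 2 (by omega : m ≤ m + v + 3)).trans (slice_two_diag (m + v + 3)).le
  have hS3 := (slice_mono_m (m + v) 3 (by omega : m ≤ m + v)).trans (slice_three_diag_le (m + v) (by omega))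
  -- Wallis: X·E ≤ 2q + 1 with E = 2^{k+3}
  have hXE := xq_mul_le (m + v + 3) (2 ^ (k + 3)) (by omega) (by rw [hE2]; omega)
  -- the arithmetic facts in ℚ
  obtain ⟨n, rfl⟩ : ∃ n, k = n + 5 := ⟨k - 5, by omega⟩
  have hpow := two_k_sub_three_mul_le_two_pow n
  have hpow' : ((2 * n + 7) * (n + 4) : ℚ) ≤ (2 : ℚ) ^ (n + 5) := by exact_mod_cast hpow
  have hEq : ((2 ^ (n + 5 + 3) : ℕ) : ℚ) = (2 : ℚ) ^ (n + 5 + 3) := by push_cast; ring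
  have hm' : ((4 ^ (n + 5 + 3) : ℕ) : ℚ) ≤ ((m + v : ℕ) : ℚ) := by exact_mod_cast (by omega : 4 ^ (n + 5 + 3) ≤ m + v)
  have hq' : ((4 ^ (n + 5 + 3) : ℕ) : ℚ) ≤ ((m + v + 3 : ℕ) : ℚ) := by exact_mod_cast (by omega : 4 ^ (n + 5 + 3) ≤ m + v + 3)
  have hEsq : ((2 : ℚ) ^ (n + 5 + 3)) ^ 2 = ((4 ^ (n + 5 + 3) : ℕ) : ℚ) := by
    push_cast; rw [← pow_mul, pow_mul']; norm_num
  have hc2 : ((v + 3 + (n + 5)).choose 2 : ℚ) = ((v : ℚ) + 3 + (n + 5)) * ((v : ℚ) + 3 + (n + 5) - 1) / 2 := by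
    rw [Nat.cast_choose_two]; push_cast; ring
  have hT : (2 : ℚ) ^ (v + 3 + (n + 5)) * 512 ≤ ((2 : ℚ) ^ (n + 5 + 3)) ^ 2 := by
    rw [← pow_mul, show (2 : ℚ) ^ (v + 3 + (n + 5)) * 512 = (2 : ℚ) ^ (v + 3 + (n + 5) + 9) by
      rw [pow_add _ (v + 3 + (n + 5)) 9]; norm_num]
    exact pow_le_pow_right₀ (by norm_num) (by omega)
  have hfin := slice_neg_finish ((v : ℚ) + 3) (n + 5) ((m + v + 3 : ℕ) : ℚ) ((m + v : ℕ) : ℚ)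
    ((4 : ℚ) ^ (m + v + 3) / ((2 * (m + v + 3)).choose (m + v + 3) : ℚ)) ((2 : ℚ) ^ (n + 5 + 3))
    _ _ _ _ _ (by exact_mod_cast (by omega : 5 ≤ n + 5)) (by exact_mod_cast (by omega : 3 ≤ v + 3))
    (by exact_mod_cast (by omega : v + 3 + 3 ≤ n + 5))
    (by calc (8 : ℚ) = 2 ^ 3 := by norm_num
      _ ≤ 2 ^ (n + 5 + 3) := pow_le_pow_right₀ (by norm_num) (by omega))
    (by rw [show (2:ℚ) ^ (n + 5 + 3) = (2:ℚ) ^ (n + 5) * 8 by rw [pow_add]; norm_num]; nlinarith [hpow'])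
    (by rw [hEsq]; exact hq') (by rw [hEsq]; exact hm') (by rw [← hEq]; exact_mod_cast hXE)
    hS1 hS2 hS3 hc2 (by positivity) hT
  push_cast at hfin hphi hR ⊢
  linarith [hfin, hphi, hR]

/-- **Rule Q's equal split fails on every truncated slice `2 ≤ u ≤ k − 3` of every family `k ≥ 5`**:
`R̂(m+u, k, m) < Φ(m+u+k, m+u)` for every `m ≥ 4^{k+3}` (`u = 2`: gen 16's `rhat_lt_phiK_of_five_le`). -/
theorem rhat_lt_phiK_of_slice (k u m : ℕ) (hk : 5 ≤ k) (hu : 2 ≤ u) (huk : u + 3 ≤ k) (hm : 4 ^ (k + 3) ≤ m) :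
    rhat (m + u) k m < phiK (m + u + k) (m + u) := by
  rcases Nat.lt_or_ge u 3 with h2 | h3
  · obtain rfl : u = 2 := by omega
    exact rhat_lt_phiK_of_five_le k hk m hm
  · obtain ⟨v, rfl⟩ : ∃ v, u = v + 3 := ⟨u - 3, by omega⟩
    rw [← add_assoc]
    exact rhat_lt_phiK_of_slice_three_le k v m hk (by omega) hm

/-- **The negative half of the slice map for every family `k ≥ 5`**: no truncated slice `2 ≤ u ≤ k − 3` is paid by Rule Q's
equal split on every cell — at `q = 4^{k+3} + u` the inequality (R̂) fails. -/
theorem not_rhat_slice_of_two_le (k u : ℕ) (hk : 5 ≤ k) (hu : 2 ≤ u) (huk : u + 3 ≤ k) :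
    ¬ ∀ q, u ≤ q → phiK (q + k) q ≤ rhat q k (q - u) := by
  intro h
  have h' := h (4 ^ (k + 3) + u) (Nat.le_add_left u _)
  rw [Nat.add_sub_cancel] at h'
  exact absurd h' (not_le.2 (rhat_lt_phiK_of_slice k u (4 ^ (k + 3)) hk hu huk le_rfl))

/-- **`rhat_slice_only_if`** — for EVERY family `k ≥ 5`: if Rule Q's equal split pays the slice `u` on every cell
`(q+k, q)`, `q ≥ u`, then `u < 2 ∨ k − 2 ≤ u`. The set of slices paid on every cell of a family `k ≥ 5` is contained in
`{0, 1} ∪ [k − 2, ∞)`; on the families `k ≤ 8` it is exactly that set (`rhat_slice_iff_le_eight`). -/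
theorem rhat_slice_only_if (k u : ℕ) (hk : 5 ≤ k) (h : ∀ q, u ≤ q → phiK (q + k) q ≤ rhat q k (q - u)) :
    u < 2 ∨ k - 2 ≤ u := by
  by_contra hcon
  rw [not_or] at hcon
  exact not_rhat_slice_of_two_le k u hk (by omega) (by omega) h


/-! ### §6 The matroid level -/

open Set Matroid

/-- **An unpaid member on every truncated slice of every family `k ≥ 5`**: for `2 ≤ u ≤ k − 3` and `q ≥ 4^{k+3} + u`, an
explicit finite matroid at the tight layer of the cell `(q+k, q)` with a member at distance `u` from the top
(`#(flatPart Z) = q − u`) whose receipt under Rule Q's equal split is below `Φ(q+k, q)`. -/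
theorem exists_unpaid_slice (k u : ℕ) (hk : 5 ≤ k) (hu : 2 ≤ u) (huk : u + 3 ≤ k) (q : ℕ) (hq : 4 ^ (k + 3) + u ≤ q) :
    ∃ (β : Type) (M : Matroid β) (hf : M.Finite) (Z : Set β), M.E.ncard = (q + k) + q ∧ Z ∈ cellMembers M (q + k) q ∧
      (flatPart M Z).ncard = q - u ∧ @ruleQRecv β M hf (q + k) q Z < phiK (q + k) q := by
  have huq : u ≤ q := le_trans (Nat.le_add_left u _) hq
  obtain ⟨m, rfl⟩ : ∃ m, q = m + u := ⟨q - u, by omega⟩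
  obtain ⟨β, M, hf, Z, hE, hZ, hP, hrecv⟩ := modelRecvEq_flatPart (m + u) k m (by omega) (Nat.le_add_right m u)
  refine ⟨β, M, hf, Z, hE, hZ, by rw [hP]; omega, ?_⟩
  rw [hrecv]
  exact rhat_lt_phiK_of_slice k u m hk hu huk (Nat.le_of_add_le_add_right hq)

/-- **The negative half of the slice map at the matroid level, every family `k ≥ 5`**: if Rule Q's equal split pays the
members at distance `u` from the top on every finite matroid of every cell `(q+k, q)`, `q ≥ u`, then `u < 2 ∨ k − 2 ≤ u`. -/
theorem ruleQ_slice_only_if (k u : ℕ) (hk : 5 ≤ k)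
    (h : ∀ (β : Type) (M : Matroid β) (hf : M.Finite) (q : ℕ), u ≤ q → M.E.ncard = (q + k) + q →
        ∀ Z ∈ cellMembers M (q + k) q, (flatPart M Z).ncard = q - u →
          phiK (q + k) q ≤ @ruleQRecv β M hf (q + k) q Z) :
    u < 2 ∨ k - 2 ≤ u := by
  by_contra hcon
  rw [not_or] at hcon
  obtain ⟨β, M, hf, Z, hE, hZ, hP, hlt⟩ :=
    exists_unpaid_slice k u hk (by omega) (by omega) (4 ^ (k + 3) + u) le_rfl
  have h1 := h β M hf (4 ^ (k + 3) + u) (Nat.le_add_left u _) hE Z hZ hP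
  exact absurd h1 (not_le.mpr hlt)

/-- **`rhat_slice_only_if` in the `m = #P` spelling**: on every family `k ≥ 5`, a member slice `u` on which Rule Q's equal
split pays every cell (R̂-form) satisfies `u < 2 ∨ k − 2 ≤ u`; restated for the tight layer of every finite matroid by
`rhat_le_ruleQRecv` this is `ruleQ_slice_only_if`. -/
theorem ruleQ_slice_only_if' (k u : ℕ) (hk : 5 ≤ k)
    (h : ∀ (β : Type) (M : Matroid β) (hf : M.Finite) (q : ℕ), u ≤ q → M.E.ncard = (q + k) + q →
        ∀ Z ∈ cellMembers M (q + k) q, (flatPart M Z).ncard = q - u →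
          phiK (q + k) q ≤ @ruleQRecv β M hf (q + k) q Z) :
    ¬ (2 ≤ u ∧ u + 3 ≤ k) := by
  intro hu
  rcases ruleQ_slice_only_if k u hk h with h1 | h1 <;> omega

end PercRepro
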